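import Literature.Analysis.ValidatedNumerics.TaylorModelIntegralCert2DAdaptive
import Literature.Analysis.ValidatedNumerics.TaylorModelMultivariateTrig
import HarnessLib

/-!
# Double-integral certificates with trigonometric nodes: rectangles, box splits, kd-trees and graph-shaped domains

Trunk T-ANA (Analysis/ValidatedNumerics); namespace `Literature.Analysis.ValidatedNumerics.PolyMP`.
Sequel of `TaylorModelIntegralCert2DElem.lean` (the grid certificate generic in a box modeller `Φ`: `certCheck2G`,
`boxCheckG` / `sumCheckG`, and the expression language `BExprE` without trigonometric nodes),
`TaylorModelIntegralCert2DAdaptive.lean` (kd-tree certificates generic in a modeller `Ψ`: `leafCheckG` / `treeCheckG` /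
`integral_bounds_of_leafCheckG`, the heuristic `kdRefine`) and `TaylorModelMultivariateTrig.lean` (`tsin2TM` / `tcos2TM`).
The generic layers are instantiated ONCE MORE, for a richer code list:

* **Part A — the expression language `BExprT`**: `const`, `varX`, `varY`, `neg`, `add`, `sub`, `mul`, `exp`, `log`,
  `inv`, `sqrt`, `sin`, `cos` with `toFun₂`, joint measurability, the box model `BExprT.model S h k P cx cy` and
  `tmem2_model` (the `sin` / `cos` nodes take their series order from `P.K` and their point-value budget
  `cisPt S P.Ke P.ke` from the exponential's fields of `EPrm`, so that kd-tree leaves keep ONE parameter record);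
* **Part B — certificates over a rectangle**: one-shot `certCheck2T` / `integral_bounds_of_certCheck2T` and box-split
  `boxCheckT` / `sumCheckT` / `integral_bounds_of_boxCheckT` (= Part A / A′ of `…2DElem` on `BExprT.model`);
* **Part C — adaptive certificates**: `leafCheckT` / `treeCheckT` / `integral_bounds_of_leafCheckT` (= the kd-tree
  certificate of `…2DAdaptive` on `BExprT.model`) and the refinement heuristic `kdRefineT`;
* **Part D — graph-shaped inner limits** `∫_{x} ∫_{y=A(x)}^{B(x)} E(x, y) dy dx` for `A`, `B` in `x` alone, by the
  substitution `y = A + t (B − A)`, `t ∈ [0, 1]` (`BExprT.substY`, `graphIntegrand`; Mathlib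
  `intervalIntegral.smul_integral_comp_mul_add`): box-split `integral_bounds_of_boxCheckGraphT` on
  `[ax, ax + 2nh] × [0, 1]` AND — new for graph domains — the ADAPTIVE form `integral_bounds_of_leafCheckGraphT` (a
  kd-tree over `[x0, x1] × [0, 1]`), so that the corner of a triangle where the integrand peaks is refined locally.

All conclusions are hypothesis-free real inequalities once the Boolean obligations hold (`decide`, one per box / leaf).
Deliberately NOT here: `tan`, `arctan`, singular integrands, dimension `3` (see `TaylorModelIntegralCert3DTrig.lean`).
Problem-independent; no facts, no axioms; all certificate data computable over `ℤ`.

## References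

* K. Makino, M. Berz, *Taylor models and other validated functional inclusion methods*, Int. J. Pure Appl. Math. 4
  (2003) 379–456: Algorithm 2 (quadrature with Taylor models: identity models, code list in Taylor-model arithmetic,
  exact integration of the polynomial part over a partition of the domain box), Definition 3 (intrinsics incl.
  `sin`, `cos`). [cite: MakinoBerz2003, Algorithm 2] [cite: MakinoBerz2003, Definition 3]
* M. Berz, K. Makino, *New methods for high-dimensional verified quadrature*, Reliable Computing 5 (1999) 13–22,
  Sect. 2. [cite: BerzMakino1999, Sect. 2]
* A. Mahboubi, G. Melquiond, T. Sibut-Pinote, *Formally verified approximations of definite integrals*, ITP 2016,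
  LNCS 9807, 274–289: Sect. 3.2 Lemma 3 (polynomial enclosure of the integral), Sect. 3.3 (adaptive splitting of the
  domain, enclosures of the pieces added and checked by computation). [cite: MahboubiMelquiondSibutpinote2016, Sect. 3.3]
* M. Joldeş, *Rigorous Polynomial Approximations and Applications*, PhD thesis, ENS Lyon (2011), Algorithm 2.2.8
  (`TMComp` for `sin`, `cos`). [cite: Joldes2011, Algorithm 2.2.8]
* P. J. Davis, P. Rabinowitz, *Methods of Numerical Integration*, 2nd ed., Academic Press (1984), Sect. 5.6.1
  (generalized product rules: the iterated integral with variable limits `∫ₐᵇ dx ∫_{ψ(x)}^{φ(x)} f(x, y) dy`,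
  (5.6.1.1)–(5.6.1.7), as the transformed integral over the square with Jacobian `J(x) = (φ(x) − ψ(x))/(b − a)`).
  [cite: DavisRabinowitz1984, Sect. 5.6.1]
* The affine change of variables in an interval integral (Mathlib `intervalIntegral.smul_integral_comp_mul_add`).
  [folklore]
-/

open MeasureTheory intervalIntegral Set
open scoped Interval

namespace Literature.Analysis.ValidatedNumerics

namespace PolyMP

open Literature.Analysis.ValidatedNumerics.NumericsMP
open Literature.Analysis.ValidatedNumerics.ExpPoly (Poly)
open Literature.Analysis.ValidatedNumerics.ExpPoly

/-! ### Part A. The expression language with trigonometric nodes -/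

/-- Integrand expressions in `x`, `y`: rational constants, the variables, `−`, `+`, binary `−`, `·`, `exp`, `log`,
reciprocal, square root, `sin`, `cos` (the code list of op. cit. Algorithm 2 over the intrinsics of Definition 3).
[cite: MakinoBerz2003, Algorithm 2] -/
inductive BExprT : Type
  /-- the rational constant `q` -/
  | const (q : ℚ) : BExprT
  /-- the first variable `x` -/
  | varX : BExprT
  /-- the second variable `y` -/
  | varY : BExprT
  /-- `−A` -/
  | neg (A : BExprT) : BExprT
  /-- `A + B` -/
  | add (A B : BExprT) : BExprT
  /-- `A − B` -/
  | sub (A B : BExprT) : BExprT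
  /-- `A · B` -/
  | mul (A B : BExprT) : BExprT
  /-- `e^{A}` -/
  | exp (A : BExprT) : BExprT
  /-- `log A` -/
  | log (A : BExprT) : BExprT
  /-- `1 / A` -/
  | inv (A : BExprT) : BExprT
  /-- `√A` -/
  | sqrt (A : BExprT) : BExprT
  /-- `sin A` -/
  | sin (A : BExprT) : BExprT
  /-- `cos A` -/
  | cos (A : BExprT) : BExprT

namespace BExprT

/-- The real function of two variables denoted by an expression (`log`, `⁻¹`, `√` are Mathlib's total functions).
[cite: MakinoBerz2003, Algorithm 2] -/
noncomputable def toFun₂ : BExprT → ℝ → ℝ → ℝ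
  | const q => fun _ _ => q
  | varX => fun x _ => x
  | varY => fun _ y => y
  | neg A => fun x y => -toFun₂ A x y
  | add A B => fun x y => toFun₂ A x y + toFun₂ B x y
  | sub A B => fun x y => toFun₂ A x y - toFun₂ B x y
  | mul A B => fun x y => toFun₂ A x y * toFun₂ B x y
  | exp A => fun x y => Real.exp (toFun₂ A x y)
  | log A => fun x y => Real.log (toFun₂ A x y)
  | inv A => fun x y => (toFun₂ A x y)⁻¹
  | sqrt A => fun x y => Real.sqrt (toFun₂ A x y)
  | sin A => fun x y => Real.sin (toFun₂ A x y)
  | cos A => fun x y => Real.cos (toFun₂ A x y)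

/-- Joint (Borel) measurability of the denoted function. [cite: MakinoBerz2003, Algorithm 2] -/
theorem measurable_toFun₂ : ∀ E : BExprT, Measurable fun z : ℝ × ℝ => E.toFun₂ z.1 z.2
  | const _ => measurable_const
  | varX => measurable_fst
  | varY => measurable_snd
  | neg A => (measurable_toFun₂ A).neg
  | add A B => (measurable_toFun₂ A).add (measurable_toFun₂ B)
  | sub A B => (measurable_toFun₂ A).sub (measurable_toFun₂ B)
  | mul A B => (measurable_toFun₂ A).mul (measurable_toFun₂ B)
  | exp A => Real.measurable_exp.comp (measurable_toFun₂ A)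
  | log A => Real.measurable_log.comp (measurable_toFun₂ A)
  | inv A => (measurable_toFun₂ A).inv
  | sqrt A => Real.continuous_sqrt.measurable.comp (measurable_toFun₂ A)
  | sin A => Real.measurable_sin.comp (measurable_toFun₂ A)
  | cos A => Real.measurable_cos.comp (measurable_toFun₂ A)

/-- **The box Taylor model of `(u, v) ↦ E(cx + u, cy + v)` on `|u| ≤ h, |v| ≤ k`** with its acceptance flag: the
identity models, then the code list in bivariate Taylor-model arithmetic; `sin` / `cos` by `tsin2TM` / `tcos2TM` with
series order `P.K` and point values `cisPt S P.Ke P.ke`. [cite: MakinoBerz2003, Algorithm 2] -/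
def model (S : ℕ) (h k : ℚ) (P : EPrm) (cx cy : ℚ) : BExprT → IPoly2 × Bool
  | const q => (tconst2 (ofRat S q), true)
  | varX => (tvarX2 S (ofRat S cx), true)
  | varY => (tvarY2 S (ofRat S cy), true)
  | neg A =>
      let r := model S h k P cx cy A
      (tneg2 r.1, r.2)
  | add A B =>
      let r := model S h k P cx cy A
      let r' := model S h k P cx cy B
      (tadd2 r.1 r'.1, r.2 && r'.2)
  | sub A B =>
      let r := model S h k P cx cy A
      let r' := model S h k P cx cy B
      (tsub2 r.1 r'.1, r.2 && r'.2)
  | mul A B =>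
      let r := model S h k P cx cy A
      let r' := model S h k P cx cy B
      (tmul2 S h k P.D r.1 r'.1, r.2 && r'.2)
  | exp A =>
      let r := model S h k P cx cy A
      let t := texp2TM S h k P.D P.K P.Ke P.ke r.1
      (t.1, r.2 && t.2)
  | log A =>
      let r := model S h k P cx cy A
      let t := tlog2TM S h k P.D P.K P.Kl r.1
      (t.1, r.2 && t.2)
  | inv A =>
      let r := model S h k P cx cy A
      let t := tinv2TM S h k P.D P.K r.1
      (t.1, r.2 && t.2)
  | sqrt A =>
      let r := model S h k P cx cy A
      let t := tsqrt2TM S h k P.D P.K P.fuel r.1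
      (t.1, r.2 && t.2)
  | sin A =>
      let r := model S h k P cx cy A
      let t := tsin2TM S h k P.D P.K P.Ke P.ke r.1
      (t.1, r.2 && t.2)
  | cos A =>
      let r := model S h k P cx cy A
      let t := tcos2TM S h k P.D P.K P.Ke P.ke r.1
      (t.1, r.2 && t.2)

/-- **Soundness of `model`**: an accepted box model encloses `(u, v) ↦ E(cx + u, cy + v)` on `|u| ≤ h, |v| ≤ k`.
[cite: MakinoBerz2003, Algorithm 2] -/
theorem tmem2_model {S : ℕ} (hS : 0 < S) {h k : ℚ} (h0 : 0 ≤ h) (k0 : 0 ≤ k) (P : EPrm) (cx cy : ℚ) :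
    ∀ E : BExprT, (model S h k P cx cy E).2 = true →
      TMem2 S h k (fun u v => E.toFun₂ ((cx : ℝ) + u) ((cy : ℝ) + v)) (model S h k P cx cy E).1
  | const q, _ => by simpa [model, toFun₂] using tmem2_const (h := h) (k := k) (mem_ofRat S q)
  | varX, _ => by simpa [model, toFun₂] using tmem2_varX (S := S) (h := h) (k := k) (mem_ofRat S cx)
  | varY, _ => by simpa [model, toFun₂] using tmem2_varY (S := S) (h := h) (k := k) (mem_ofRat S cy)
  | neg A, hok => by
      simp only [model] at hok ⊢
      exact tmem2_neg (tmem2_model hS h0 k0 P cx cy A hok)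
  | add A B, hok => by
      simp only [model, Bool.and_eq_true] at hok ⊢
      exact tmem2_add (tmem2_model hS h0 k0 P cx cy A hok.1) (tmem2_model hS h0 k0 P cx cy B hok.2)
  | sub A B, hok => by
      simp only [model, Bool.and_eq_true] at hok ⊢
      exact tmem2_sub (tmem2_model hS h0 k0 P cx cy A hok.1) (tmem2_model hS h0 k0 P cx cy B hok.2)
  | mul A B, hok => by
      simp only [model, Bool.and_eq_true] at hok ⊢
      exact tmem2_mul hS h0 k0 P.D (tmem2_model hS h0 k0 P cx cy A hok.1) (tmem2_model hS h0 k0 P cx cy B hok.2)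
  | exp A, hok => by
      simp only [model, Bool.and_eq_true] at hok ⊢
      exact tmem2_exp_of_texp2TM hS h0 k0 (tmem2_model hS h0 k0 P cx cy A hok.1) hok.2
  | log A, hok => by
      simp only [model, Bool.and_eq_true] at hok ⊢
      exact tmem2_log_of_tlog2TM hS h0 k0 (tmem2_model hS h0 k0 P cx cy A hok.1) hok.2
  | inv A, hok => by
      simp only [model, Bool.and_eq_true] at hok ⊢
      exact tmem2_inv_of_tinv2TM hS h0 k0 (tmem2_model hS h0 k0 P cx cy A hok.1) hok.2
  | sqrt A, hok => by
      simp only [model, Bool.and_eq_true] at hok ⊢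
      exact tmem2_sqrt_of_tsqrt2TM hS h0 k0 (tmem2_model hS h0 k0 P cx cy A hok.1) hok.2
  | sin A, hok => by
      simp only [model, Bool.and_eq_true] at hok ⊢
      exact tmem2_sin_of_tsin2TM hS h0 k0 (tmem2_model hS h0 k0 P cx cy A hok.1) hok.2
  | cos A, hok => by
      simp only [model, Bool.and_eq_true] at hok ⊢
      exact tmem2_cos_of_tcos2TM hS h0 k0 (tmem2_model hS h0 k0 P cx cy A hok.1) hok.2

/-- The box modeller of an expression in the shape the kd-tree layer expects. [cite: MakinoBerz2003, Algorithm 2] -/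
def psi (S : ℕ) (E : BExprT) : ℚ → ℚ → ℚ → ℚ → EPrm → IPoly2 × Bool :=
  fun h k cx cy P => model S h k P cx cy E

end BExprT

/-! ### Part B. Certificates over a rectangle (one-shot and box-split) -/

/-- **The one-shot certificate for `BExprT` integrands over a rectangle** (`= certCheck2G` on `BExprT.model`).
[cite: MakinoBerz2003, Algorithm 2] -/
def certCheck2T (S : ℕ) (h k : ℚ) (P : EPrm) (E : BExprT) (ax ay : ℚ) (n m : ℕ) (lo hi : ℚ) : Bool :=
  certCheck2G S h k (fun cx cy => BExprT.model S h k P cx cy E) ax ay n m lo hi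

/-- **Soundness** (no side hypotheses): `certCheck2T … = true → lo ≤ ∫_{ax}^{ax+2nh} ∫_{ay}^{ay+2mk} E ≤ hi`.
[cite: MakinoBerz2003, Algorithm 2] [cite: MahboubiMelquiondSibutpinote2016, Sect. 3.3] -/
theorem integral_bounds_of_certCheck2T {S : ℕ} {h k : ℚ} {P : EPrm} {E : BExprT} {ax ay : ℚ} {n m : ℕ}
    {lo hi : ℚ} (hc : certCheck2T S h k P E ax ay n m lo hi = true) :
    (lo : ℝ) ≤ ∫ x in (ax : ℝ)..((ax : ℝ) + 2 * n * h), ∫ y in (ay : ℝ)..((ay : ℝ) + 2 * m * k), E.toFun₂ x y ∧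
      ∫ x in (ax : ℝ)..((ax : ℝ) + 2 * n * h), ∫ y in (ay : ℝ)..((ay : ℝ) + 2 * m * k), E.toFun₂ x y ≤ (hi : ℝ) := by
  have hpos : 0 < S ∧ 0 < h ∧ 0 < k := by
    unfold certCheck2T certCheck2G at hc
    simp only [Bool.and_eq_true, decide_eq_true_eq] at hc
    exact ⟨hc.1.1.1.1.1, hc.1.1.1.1.2, hc.1.1.1.2⟩
  exact integral_bounds_of_certCheck2G (BExprT.measurable_toFun₂ E)
    (fun cx cy hok => BExprT.tmem2_model hpos.1 hpos.2.1.le hpos.2.2.le P cx cy E hok) hc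

/-- **Box-split certificate for `BExprT` integrands, kernel obligation for box `(i, j)`.**
[cite: MakinoBerz2003, Algorithm 2] -/
def boxCheckT (S : ℕ) (h k : ℚ) (P : EPrm) (E : BExprT) (ax ay : ℚ) (Jss : List (List MI)) (i j : ℕ) : Bool :=
  boxCheckG S h k (fun cx cy => BExprT.model S h k P cx cy E) ax ay Jss i j

/-- **Box-split certificate for `BExprT` integrands, final obligation.** [cite: MakinoBerz2003, Algorithm 2] -/
def sumCheckT (S : ℕ) (h k : ℚ) (P : EPrm) (E : BExprT) (ax ay : ℚ) (Jss : List (List MI)) (n m : ℕ)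
    (lo hi : ℚ) : Bool :=
  sumCheckG S h k (fun cx cy => BExprT.model S h k P cx cy E) ax ay Jss n m lo hi

/-- **Soundness of the box-split certificate** (no side hypotheses).
[cite: MakinoBerz2003, Algorithm 2] [cite: MahboubiMelquiondSibutpinote2016, Sect. 3.3] -/
theorem integral_bounds_of_boxCheckT {S : ℕ} {h k : ℚ} {P : EPrm} {E : BExprT} {ax ay : ℚ}
    {Jss : List (List MI)} {n m : ℕ} {lo hi : ℚ}
    (hbox : ∀ i j : ℕ, i < n → j < m → boxCheckT S h k P E ax ay Jss i j = true)
    (hsum : sumCheckT S h k P E ax ay Jss n m lo hi = true) :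
    (lo : ℝ) ≤ ∫ x in (ax : ℝ)..((ax : ℝ) + 2 * n * h), ∫ y in (ay : ℝ)..((ay : ℝ) + 2 * m * k), E.toFun₂ x y ∧
      ∫ x in (ax : ℝ)..((ax : ℝ) + 2 * n * h), ∫ y in (ay : ℝ)..((ay : ℝ) + 2 * m * k), E.toFun₂ x y ≤ (hi : ℝ) := by
  have hpos : 0 < S ∧ 0 < h ∧ 0 < k := by
    unfold sumCheckT sumCheckG at hsum
    simp only [Bool.and_eq_true, decide_eq_true_eq] at hsum
    exact ⟨hsum.1.1.1.1, hsum.1.1.1.2, hsum.1.1.2⟩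
  exact integral_bounds_of_boxCheckG (BExprT.measurable_toFun₂ E)
    (fun cx cy hok => BExprT.tmem2_model hpos.1 hpos.2.1.le hpos.2.2.le P cx cy E hok) hbox hsum

/-! ### Part C. Adaptive (kd-tree) certificates -/

/-- Kernel obligation for leaf `i`, `BExprT` integrand (one `decide` per leaf; vacuous past the last leaf).
[cite: MahboubiMelquiondSibutpinote2016, Sect. 3.3] -/
def leafCheckT (S : ℕ) (E : BExprT) (t : KdTree2) (B : Box2Q) (i : ℕ) : Bool :=
  leafCheckG S (BExprT.psi S E) t B i

/-- Final obligation (`= treeCheckG`: positivity of `S`, leaf count, `Σ claims ⊆ [lo·S, hi·S]`).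
[cite: MahboubiMelquiondSibutpinote2016, Sect. 3.3] -/
def treeCheckT (S : ℕ) (t : KdTree2) (n : ℕ) (lo hi : ℚ) : Bool := treeCheckG S t n lo hi

/-- **Soundness of the adaptive certificate for `BExprT` integrands** (no side hypotheses).
[cite: MakinoBerz2003, Algorithm 2] [cite: MahboubiMelquiondSibutpinote2016, Sect. 3.3] -/
theorem integral_bounds_of_leafCheckT {S : ℕ} {E : BExprT} {t : KdTree2} {B : Box2Q} {n : ℕ} {lo hi : ℚ}
    (hleaf : ∀ i : ℕ, i < n → leafCheckT S E t B i = true) (ht : treeCheckT S t n lo hi = true) :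
    (lo : ℝ) ≤ ∫ x in (B.x0 : ℝ)..B.x1, ∫ y in (B.y0 : ℝ)..B.y1, E.toFun₂ x y ∧
      ∫ x in (B.x0 : ℝ)..B.x1, ∫ y in (B.y0 : ℝ)..B.y1, E.toFun₂ x y ≤ (hi : ℝ) :=
  integral_bounds_of_leafCheckG (BExprT.measurable_toFun₂ E)
    (fun _ _ cx cy P hS h0 k0 hok => BExprT.tmem2_model hS h0 k0 P cx cy E hok) hleaf ht

/-- **Refinement heuristic** (bisection of the longer side while rejected or wider than `tol`, at most `depth` deep;
a PROPOSAL certified leaf by leaf). [cite: MahboubiMelquiondSibutpinote2016, Sect. 3.3] -/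
def kdRefineT (S : ℕ) (E : BExprT) (P : EPrm) (tol : ℤ) : ℕ → Box2Q → KdTree2
  | 0, B => KdTree2.leaf P (leafEncl S (BExprT.psi S E) B P).1
  | d + 1, B =>
      let e := leafEncl S (BExprT.psi S E) B P
      if e.2 && decide (e.1.hi - e.1.lo ≤ tol) then KdTree2.leaf P e.1
      else if B.y1 - B.y0 ≤ B.x1 - B.x0 then
        let c := (B.x0 + B.x1) / 2
        KdTree2.splitX c (kdRefineT S E P tol d ⟨B.x0, c, B.y0, B.y1⟩) (kdRefineT S E P tol d ⟨c, B.x1, B.y0, B.y1⟩)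
      else
        let c := (B.y0 + B.y1) / 2
        KdTree2.splitY c (kdRefineT S E P tol d ⟨B.x0, B.x1, B.y0, c⟩) (kdRefineT S E P tol d ⟨B.x0, B.x1, c, B.y1⟩)

/-! ### Part D. Graph-shaped inner limits by substitution (box-split and adaptive) -/

namespace BExprT

/-- Substitute the expression `W` for the second variable. [cite: MakinoBerz2003, Algorithm 2] -/
def substY (W : BExprT) : BExprT → BExprT
  | const q => const q
  | varX => varX
  | varY => W
  | neg A => neg (substY W A)
  | add A B => add (substY W A) (substY W B)
  | sub A B => sub (substY W A) (substY W B)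
  | mul A B => mul (substY W A) (substY W B)
  | exp A => exp (substY W A)
  | log A => log (substY W A)
  | inv A => inv (substY W A)
  | sqrt A => sqrt (substY W A)
  | sin A => sin (substY W A)
  | cos A => cos (substY W A)

/-- [cite: MakinoBerz2003, Algorithm 2] -/
theorem toFun₂_substY (W : BExprT) (x y : ℝ) : ∀ E : BExprT, (substY W E).toFun₂ x y = E.toFun₂ x (W.toFun₂ x y)
  | const _ => rfl
  | varX => rfl
  | varY => rfl
  | neg A => by simp only [substY, toFun₂, toFun₂_substY W x y A]
  | add A B => by simp only [substY, toFun₂, toFun₂_substY W x y A, toFun₂_substY W x y B]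
  | sub A B => by simp only [substY, toFun₂, toFun₂_substY W x y A, toFun₂_substY W x y B]
  | mul A B => by simp only [substY, toFun₂, toFun₂_substY W x y A, toFun₂_substY W x y B]
  | exp A => by simp only [substY, toFun₂, toFun₂_substY W x y A]
  | log A => by simp only [substY, toFun₂, toFun₂_substY W x y A]
  | inv A => by simp only [substY, toFun₂, toFun₂_substY W x y A]
  | sqrt A => by simp only [substY, toFun₂, toFun₂_substY W x y A]
  | sin A => by simp only [substY, toFun₂, toFun₂_substY W x y A]
  | cos A => by simp only [substY, toFun₂, toFun₂_substY W x y A]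

/-- The expression does not mention the second variable. [cite: MakinoBerz2003, Algorithm 2] -/
def xOnly : BExprT → Bool
  | const _ => true
  | varX => true
  | varY => false
  | neg A => xOnly A
  | add A B => xOnly A && xOnly B
  | sub A B => xOnly A && xOnly B
  | mul A B => xOnly A && xOnly B
  | exp A => xOnly A
  | log A => xOnly A
  | inv A => xOnly A
  | sqrt A => xOnly A
  | sin A => xOnly A
  | cos A => xOnly A

/-- An `xOnly` expression denotes a function of `x` alone. [cite: MakinoBerz2003, Algorithm 2] -/
theorem toFun₂_eq_of_xOnly (x y y' : ℝ) : ∀ A : BExprT, A.xOnly = true → A.toFun₂ x y = A.toFun₂ x y'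
  | const _, _ => rfl
  | varX, _ => rfl
  | varY, h => by simp [xOnly] at h
  | neg A, h => by
      simp only [xOnly] at h
      simp only [toFun₂, toFun₂_eq_of_xOnly x y y' A h]
  | add A B, h => by
      simp only [xOnly, Bool.and_eq_true] at h
      simp only [toFun₂, toFun₂_eq_of_xOnly x y y' A h.1, toFun₂_eq_of_xOnly x y y' B h.2]
  | sub A B, h => by
      simp only [xOnly, Bool.and_eq_true] at h
      simp only [toFun₂, toFun₂_eq_of_xOnly x y y' A h.1, toFun₂_eq_of_xOnly x y y' B h.2]
  | mul A B, h => by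
      simp only [xOnly, Bool.and_eq_true] at h
      simp only [toFun₂, toFun₂_eq_of_xOnly x y y' A h.1, toFun₂_eq_of_xOnly x y y' B h.2]
  | exp A, h => by
      simp only [xOnly] at h
      simp only [toFun₂, toFun₂_eq_of_xOnly x y y' A h]
  | log A, h => by
      simp only [xOnly] at h
      simp only [toFun₂, toFun₂_eq_of_xOnly x y y' A h]
  | inv A, h => by
      simp only [xOnly] at h
      simp only [toFun₂, toFun₂_eq_of_xOnly x y y' A h]
  | sqrt A, h => by
      simp only [xOnly] at h
      simp only [toFun₂, toFun₂_eq_of_xOnly x y y' A h]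
  | sin A, h => by
      simp only [xOnly] at h
      simp only [toFun₂, toFun₂_eq_of_xOnly x y y' A h]
  | cos A, h => by
      simp only [xOnly] at h
      simp only [toFun₂, toFun₂_eq_of_xOnly x y y' A h]

/-- The pulled-back integrand on the unit `t`-interval: `E(x, A + t·(B − A)) · (B − A)` (`t` = the second variable).
[cite: MakinoBerz2003, Algorithm 2] -/
def graphIntegrand (E A B : BExprT) : BExprT :=
  mul (substY (add A (mul varY (sub B A))) E) (sub B A)

end BExprT

/-- **The substitution `y = A(x) + t (B(x) − A(x))`, `t ∈ [0, 1]`** (valid for every sign of `B − A`; interval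
integrals are oriented): `∫_{x} ∫_{t=0}^{1} graphIntegrand = ∫_{x} ∫_{y=A(x)}^{B(x)} E` — the transformed
integral over the square of Davis–Rabinowitz (5.6.1.1)–(5.6.1.7), inner square side normalised to `[0, 1]`.
[cite: DavisRabinowitz1984, Sect. 5.6.1] -/
theorem integral_graphIntegrand_eq {E A B : BExprT} (hA : A.xOnly = true) (hB : B.xOnly = true) (ax bx : ℝ) :
    ∫ x in ax..bx, ∫ t in (0 : ℝ)..1, (BExprT.graphIntegrand E A B).toFun₂ x t =
      ∫ x in ax..bx, ∫ y in (A.toFun₂ x 0)..(B.toFun₂ x 0), E.toFun₂ x y := by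
  refine intervalIntegral.integral_congr fun x _ => ?_
  have hpt : ∀ t : ℝ, (BExprT.graphIntegrand E A B).toFun₂ x t =
      (B.toFun₂ x 0 - A.toFun₂ x 0) * E.toFun₂ x ((B.toFun₂ x 0 - A.toFun₂ x 0) * t + A.toFun₂ x 0) := by
    intro t
    simp only [BExprT.graphIntegrand, BExprT.toFun₂, BExprT.toFun₂_substY,
      BExprT.toFun₂_eq_of_xOnly x t 0 A hA, BExprT.toFun₂_eq_of_xOnly x t 0 B hB]
    ring_nf
  show ∫ t in (0 : ℝ)..1, (BExprT.graphIntegrand E A B).toFun₂ x t = _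
  simp_rw [hpt]
  rw [intervalIntegral.integral_const_mul, ← smul_eq_mul,
    intervalIntegral.smul_integral_comp_mul_add (fun y => E.toFun₂ x y)]
  simp

/-- [folklore] -/
private theorem unit_panels_tr {m : ℕ} (hm : 0 < m) :
    ((0 : ℚ) : ℝ) + 2 * (m : ℝ) * (((1 / (2 * (m : ℚ))) : ℚ) : ℝ) = 1 ∧ ((0 : ℚ) : ℝ) = 0 := by
  have hmr : (0 : ℝ) < m := by exact_mod_cast hm
  refine ⟨?_, by push_cast; rfl⟩
  have hm0 : (m : ℝ) ≠ 0 := hmr.ne'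
  push_cast
  field_simp
  ring

/-- **Soundness of the box-split graph certificate** `lo ≤ ∫_{ax}^{ax+2nh} ∫_{A(x)}^{B(x)} E(x, y) dy dx ≤ hi`: `A`, `B`
mention `x` only, `0 < m`, every box of the pulled-back integrand on `[ax, ax + 2nh] × [0, 1]` (t-panels of half-width
`1/(2m)`) passes `boxCheckT` against its claim, and `sumCheckT` holds. [cite: MakinoBerz2003, Algorithm 2]
[cite: MahboubiMelquiondSibutpinote2016, Sect. 3.3] -/
theorem integral_bounds_of_boxCheckGraphT {S : ℕ} {h : ℚ} {P : EPrm} {E A B : BExprT} {ax : ℚ}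
    {Jss : List (List MI)} {n m : ℕ} {lo hi : ℚ} (hA : A.xOnly = true) (hB : B.xOnly = true) (hm : 0 < m)
    (hbox : ∀ i j : ℕ, i < n → j < m →
      boxCheckT S h (1 / (2 * (m : ℚ))) P (BExprT.graphIntegrand E A B) ax 0 Jss i j = true)
    (hsum : sumCheckT S h (1 / (2 * (m : ℚ))) P (BExprT.graphIntegrand E A B) ax 0 Jss n m lo hi = true) :
    (lo : ℝ) ≤ ∫ x in (ax : ℝ)..((ax : ℝ) + 2 * n * h), ∫ y in (A.toFun₂ x 0)..(B.toFun₂ x 0), E.toFun₂ x y ∧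
      ∫ x in (ax : ℝ)..((ax : ℝ) + 2 * n * h), ∫ y in (A.toFun₂ x 0)..(B.toFun₂ x 0), E.toFun₂ x y ≤ (hi : ℝ) := by
  have hb := integral_bounds_of_boxCheckT hbox hsum
  obtain ⟨e1, e0⟩ := unit_panels_tr hm
  rw [e1, e0, integral_graphIntegrand_eq hA hB] at hb
  exact hb

/-- **Soundness of the ADAPTIVE graph certificate** `lo ≤ ∫_{x0}^{x1} ∫_{A(x)}^{B(x)} E(x, y) dy dx ≤ hi`: `A`, `B` mention
`x` only, and a kd-tree over `[x0, x1] × [0, 1]` certifies the pulled-back integrand leaf by leaf (the corner of a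
triangle is thereby refined where the integrand demands it). [cite: MakinoBerz2003, Algorithm 2]
[cite: MahboubiMelquiondSibutpinote2016, Sect. 3.3] -/
theorem integral_bounds_of_leafCheckGraphT {S : ℕ} {E A B : BExprT} {t : KdTree2} {x0 x1 : ℚ} {n : ℕ} {lo hi : ℚ}
    (hA : A.xOnly = true) (hB : B.xOnly = true)
    (hleaf : ∀ i : ℕ, i < n → leafCheckT S (BExprT.graphIntegrand E A B) t ⟨x0, x1, 0, 1⟩ i = true)
    (ht : treeCheckT S t n lo hi = true) :
    (lo : ℝ) ≤ ∫ x in (x0 : ℝ)..x1, ∫ y in (A.toFun₂ x 0)..(B.toFun₂ x 0), E.toFun₂ x y ∧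
      ∫ x in (x0 : ℝ)..x1, ∫ y in (A.toFun₂ x 0)..(B.toFun₂ x 0), E.toFun₂ x y ≤ (hi : ℝ) := by
  have hb := integral_bounds_of_leafCheckT hleaf ht
  dsimp only at hb
  rw [Rat.cast_zero, Rat.cast_one, integral_graphIntegrand_eq hA hB] at hb
  exact hb

end PolyMP

end Literature.Analysis.ValidatedNumerics
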